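import Mathlib
import Summits.NavierStokesRegularity.NavierStokesRegularity.Theorems.WakeRatchetTailRatchetRelayDecay
import HarnessLib

/-!
# `WakeRatchet.TailRatchet` (stmt-NavierStokesRegularity-21808): SHARPER DECAY of the normalised backward
# pantograph solution — the bordered inverse maps `Y_{3/4}` into `X_{3/4}` (bootstrap past `γ = ½`)

Support file for the crux `TailRatchet` (route `WakeRatchet`; MODEL lattice ODEs of Tao 2016 §1.2, §4 —
nothing in this file is a statement about the Navier–Stokes equations, and no item is closed here).

Context (census of stmt-21808, continuation programme R-glob, step G−1).  `…RelayDecay.pantograph_decay` gives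
the rate `e^{γt}` only for `γ ≤ ½`, because the pantograph term `2e^{t/2}h(t/2)` is bounded there using
`|h| ≤ B` alone.  Feeding the `γ = ½` rate back into that term (`2e^{s/2}|h(s/2)| ≤ 2C e^{3s/4}`) gives the
rate `e^{3t/4}` for forcings in `Y_{3/4}`; iterating once more would give `7/8`, etc.  The `3/4` class is what
the continuation in `s` up to `s = 2` needs: for states with `|h|, |h'| ≲ e^{3t/4}` the dilated quadratic term
`(4/s²)h(t/s)²` has decay to spare in the `e^{t/2}` class even at `s = 2` (cf. `…RelayDilationLipschitzForcing`,
where `σ < 2` had to be imposed at `γ = ½`).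

* `pantograph_decay_three_quarters` — `|f| ≤ Ae^{3t/4}`, `h` bounded by `B`, normalised, decaying ⇒
  `|h(t)| ≤ (4/3)(8B + 5A)·e^{3t/4}`;
* `pantograph_deriv_decay_three_quarters` — and `|h'(t)| ≤ (2·(4/3)(8B+5A) + A)·e^{3t/4}`.

HONEST FRAMING: elementary real analysis; MODEL lattice only; the construction item and the crux stay open.
-/

noncomputable section

set_option linter.dupNamespace false

namespace Summit.NavierStokesRegularity.NavierStokesRegularity.Theorems

namespace WakeRatchetRelayDecaySharp

open MeasureTheory Set Filter Topology Real
open WakeRatchetRelayBordered WakeRatchetRelayDecay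

variable {f h : ℝ → ℝ} {A B : ℝ}

/-- **DECAY RATE `3/4` (bootstrap).**  Let `|f(t)| ≤ Ae^{3t/4}` on `t ≤ 0` with `f` integrable there, and let
`h` be continuous and bounded (`|h| ≤ B`) on `(−∞,0]`, solving `h' = 2e^{t/2}h(t/2) + f` on `t < 0`, with
`h(t) → 0` as `t → −∞`.  Then `|h(t)| ≤ (4/3)(8B + 5A)e^{3t/4}` for every `t ≤ 0`.
[cite: Tao2016AveragedNS, §1.2 (dyadic model); cell vocabulary (weighted spaces of programme R-lac/R-glob, census of stmt-21808)] -/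
theorem pantograph_decay_three_quarters (hfA : ∀ t : ℝ, t ≤ 0 → |f t| ≤ A * Real.exp (3 / 4 * t))
    (hfi : IntegrableOn f (Iic 0)) (hcont : ContinuousOn h (Iic 0))
    (hde : ∀ t : ℝ, t < 0 → HasDerivAt h (2 * Real.exp (t / 2) * h (t / 2) + f t) t)
    (hB : ∀ t : ℝ, t ≤ 0 → |h t| ≤ B) (hlim : Tendsto h atBot (𝓝 0)) {t : ℝ} (ht : t ≤ 0) :
    |h t| ≤ 4 / 3 * (8 * B + 5 * A) * Real.exp (3 / 4 * t) := by
  have hB0 : 0 ≤ B := (abs_nonneg _).trans (hB 0 le_rfl)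
  have hA0 : 0 ≤ A := by
    have := hfA 0 le_rfl
    rw [mul_zero, Real.exp_zero, mul_one] at this
    exact (abs_nonneg _).trans this
  -- step 1: the `γ = 1/2` rate
  have hfA' : ∀ s : ℝ, s ≤ 0 → |f s| ≤ A * Real.exp (1 / 2 * s) := fun s hs =>
    (hfA s hs).trans (mul_le_mul_of_nonneg_left (Real.exp_le_exp.2 (by nlinarith)) hA0)
  have h12 : ∀ s : ℝ, s ≤ 0 → |h s| ≤ (4 * B + A / (1 / 2)) * Real.exp (1 / 2 * s) := fun s hs =>
    pantograph_decay (γ := 1 / 2) (by norm_num) le_rfl hfA' hfi hcont hde hB hlim hs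
  set C₁ : ℝ := 4 * B + A / (1 / 2) with hC₁
  have hC₁eq : C₁ = 4 * B + 2 * A := by rw [hC₁]; ring
  have hC₁0 : 0 ≤ C₁ := by rw [hC₁eq]; positivity
  -- step 2: the fundamental theorem on `(−∞, t]` with the improved majorant
  set G : ℝ → ℝ := fun s => 2 * Real.exp (s / 2) * h (s / 2) + f s with hG
  have hGint0 : IntegrableOn G (Iic 0) := deriv_integrableOn_of_bounded hfi hcont hB
  have hGint : IntegrableOn G (Iic t) := hGint0.mono_set (Iic_subset_Iic.2 ht)
  have hcw : ContinuousWithinAt h (Iic t) t := (hcont t ht).mono (Iic_subset_Iic.2 ht)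
  have hFTC := integral_Iic_of_hasDerivAt_of_tendsto hcw
    (fun x hx => hde x (lt_of_lt_of_le hx ht)) hGint hlim
  rw [sub_zero] at hFTC
  have hk : (0 : ℝ) < 3 / 4 := by norm_num
  have hmaj_int : IntegrableOn (fun s : ℝ => (2 * C₁ + A) * Real.exp (3 / 4 * s)) (Iic t) :=
    (integrableOn_exp_mul_Iic hk t).const_mul _
  have hle : ∀ s ∈ Iic t, ‖G s‖ ≤ (2 * C₁ + A) * Real.exp (3 / 4 * s) := by
    intro s hs
    have hs0 : s ≤ 0 := le_trans hs ht
    have hh := h12 (s / 2) (by linarith)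
    have hee : Real.exp (s / 2) * Real.exp (1 / 2 * (s / 2)) = Real.exp (3 / 4 * s) := by
      rw [← Real.exp_add]; ring_nf
    rw [Real.norm_eq_abs]
    calc |G s| ≤ |2 * Real.exp (s / 2) * h (s / 2)| + |f s| := abs_add_le _ _
      _ = 2 * Real.exp (s / 2) * |h (s / 2)| + |f s| := by
          rw [abs_mul, abs_mul, abs_two, abs_of_pos (Real.exp_pos _)]
      _ ≤ 2 * Real.exp (s / 2) * (C₁ * Real.exp (1 / 2 * (s / 2))) + A * Real.exp (3 / 4 * s) :=
          add_le_add (mul_le_mul_of_nonneg_left hh (by positivity)) (hfA s hs0)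
      _ = 2 * C₁ * (Real.exp (s / 2) * Real.exp (1 / 2 * (s / 2))) + A * Real.exp (3 / 4 * s) := by ring
      _ = (2 * C₁ + A) * Real.exp (3 / 4 * s) := by rw [hee]; ring
  have h1 : ‖∫ s in Iic t, G s‖ ≤ ∫ s in Iic t, ‖G s‖ := norm_integral_le_integral_norm _
  have h2 : ∫ s in Iic t, ‖G s‖ ≤ ∫ s in Iic t, (2 * C₁ + A) * Real.exp (3 / 4 * s) :=
    setIntegral_mono_on hGint.norm hmaj_int measurableSet_Iic hle
  have h3 : ∫ s in Iic t, (2 * C₁ + A) * Real.exp (3 / 4 * s) = (2 * C₁ + A) / (3 / 4) * Real.exp (3 / 4 * t) := by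
    rw [integral_const_mul, integral_exp_mul_Iic hk]
    field_simp
  rw [← hFTC, ← Real.norm_eq_abs]
  calc ‖∫ s in Iic t, G s‖ ≤ (2 * C₁ + A) / (3 / 4) * Real.exp (3 / 4 * t) := by linarith [h1, h2, h3]
    _ = 4 / 3 * (8 * B + 5 * A) * Real.exp (3 / 4 * t) := by rw [hC₁eq]; ring

/-- **DECAY OF THE DERIVATIVE at rate `3/4`.**  Under the hypotheses of `pantograph_decay_three_quarters`,
`|2e^{t/2}h(t/2) + f(t)| ≤ (2·(4/3)(8B + 5A) + A)e^{3t/4}` on `t ≤ 0`: the solution lies in `X_{3/4}`. [folklore] -/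
theorem pantograph_deriv_decay_three_quarters (hfA : ∀ t : ℝ, t ≤ 0 → |f t| ≤ A * Real.exp (3 / 4 * t))
    (hfi : IntegrableOn f (Iic 0)) (hcont : ContinuousOn h (Iic 0))
    (hde : ∀ t : ℝ, t < 0 → HasDerivAt h (2 * Real.exp (t / 2) * h (t / 2) + f t) t)
    (hB : ∀ t : ℝ, t ≤ 0 → |h t| ≤ B) (hlim : Tendsto h atBot (𝓝 0)) {t : ℝ} (ht : t ≤ 0) :
    |2 * Real.exp (t / 2) * h (t / 2) + f t| ≤
      (2 * (4 / 3 * (8 * B + 5 * A)) + A) * Real.exp (3 / 4 * t) := by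
  have hB0 : 0 ≤ B := (abs_nonneg _).trans (hB 0 le_rfl)
  have hA0 : 0 ≤ A := by
    have := hfA 0 le_rfl
    rw [mul_zero, Real.exp_zero, mul_one] at this
    exact (abs_nonneg _).trans this
  have hh := pantograph_decay_three_quarters hfA hfi hcont hde hB hlim (show t / 2 ≤ 0 by linarith)
  have hexp : Real.exp (t / 2) * Real.exp (3 / 4 * (t / 2)) ≤ Real.exp (3 / 4 * t) := by
    rw [← Real.exp_add]; exact Real.exp_le_exp.2 (by nlinarith)
  have hK : 0 ≤ 4 / 3 * (8 * B + 5 * A) := by positivity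
  calc |2 * Real.exp (t / 2) * h (t / 2) + f t| ≤ |2 * Real.exp (t / 2) * h (t / 2)| + |f t| :=
        abs_add_le _ _
    _ = 2 * Real.exp (t / 2) * |h (t / 2)| + |f t| := by
        rw [abs_mul, abs_mul, abs_two, abs_of_pos (Real.exp_pos _)]
    _ ≤ 2 * Real.exp (t / 2) * (4 / 3 * (8 * B + 5 * A) * Real.exp (3 / 4 * (t / 2))) +
          A * Real.exp (3 / 4 * t) :=
        add_le_add (mul_le_mul_of_nonneg_left hh (by positivity)) (hfA t ht)
    _ = 2 * (4 / 3 * (8 * B + 5 * A)) * (Real.exp (t / 2) * Real.exp (3 / 4 * (t / 2))) +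
          A * Real.exp (3 / 4 * t) := by ring
    _ ≤ 2 * (4 / 3 * (8 * B + 5 * A)) * Real.exp (3 / 4 * t) + A * Real.exp (3 / 4 * t) := by
        have := mul_le_mul_of_nonneg_left hexp (by positivity : (0 : ℝ) ≤ 2 * (4 / 3 * (8 * B + 5 * A)))
        linarith
    _ = (2 * (4 / 3 * (8 * B + 5 * A)) + A) * Real.exp (3 / 4 * t) := by ring

end WakeRatchetRelayDecaySharp

end Summit.NavierStokesRegularity.NavierStokesRegularity.Theorems

end
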